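import Summits.Ventures.YMGap.RobustBall.UniformMassGapZdG
import Summits.Ventures.YMGap.RobustBall.LocalSourceScreening
import Literature.Probability.LatticeModels.DobrushinShlosmanGibbsPair
import HarnessLib

/-!
# Venture YMGap, track ROBUST-BALL (Y2) — LOCAL SOURCES ARE SCREENED THROUGH THE STAR DOOR:
# exponential quasi-locality of `W ↦ μ_W` on the GAUGE-INVARIANT tier-1 `ℤ^d` ball, past the single-link threshold

HONEST FRAMING. WHAT THIS IS: a venture file (cell `pub-ymgap`, track Y2 ROBUST-BALL, seat rb-p1, theorems only).
Strong-coupling LATTICE statements for `SU(N)` lattice Yang–Mills on `ℤ^d`. The screening theorems of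
`LocalSourceScreening[Metric|Ball].lean` run through a SINGLE-LINK Dobrushin door (`IsKRContraction`, row sums
`≤ ρ < 1`), which for `SU(2)`, `d = 4` closes only below `β_W = 2/9`. This file runs the same statement through
ds-2's VERTEX-STAR door on `ℤ^d` (`StarWindowBoundZdR`, Dobrushin–Shlosman window contraction of the star kernels,
`StarDoorZd.lean` / `RobustStarDoorZd.lean`), which closes on the gauge-invariant tier-1 ball `MemBallZdG ε₀ ε₁ R`
up to `β_W = 1/3` (`MassGapOnBallZdGRows.lean`).

SETTING. A member `(W, supp)`: continuous own-link terms, support family of `ℓ^∞` range `R`, whose `SU(N)`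
specification `perturbedYM (fundamentalRep (Fin N)) (N β) W supp` has a star window bound with locality radius
`D ≥ R + 2` and received sum `0 ≤ ρ < 1`. A SOURCE: ANY bounded adapted link potential `V`, locally listed by `suppV`,
whose terms read only the links of a finite set `S` (`DependsOn (V X) S` for every `X`) — a Wilson-loop insertion
`t · Re tr U_C / N` of any size and ANY strength `t`, couplings changed on the plaquettes inside `S`, any finite
collection of gauge-invariant insertions. Nothing else is asked of `V`.

THE THEOREM (`abs_integral_sub_integral_le_of_source_star`). For every DLR state `μ` of the member, EVERY DLR state
`ν` of `W + V` (listed by `supp ∪ suppV`) and every bounded measurable `f` reading `Δ` with Frobenius-Lipschitz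
vector `δ`:

  `|∫ f dμ − ∫ f dν| ≤ 4√N · e^{−κ ⌊d(Δ,S)/(D+2)⌋} · Σ_{y ∈ Δ} δ_y`,  `κ = starRate d ρ = (1−ρ)²/(2(4dρ+1))`,

(`d(Δ,S)` = `setDistEdges`, the sup-distance of base points); exponential reading `≤ 8√N e^{−(κ/(D+2)) d(Δ,S)} Σ δ`
(`…_exp`), Lipschitz-cylinder reading `Σ δ = #Λ_F · K_F` (`…_cylinder`), and the BALL form
(`localScreeningStar_of_memBallZdG`): under the hypotheses of ds-2's `massGapOnBallZdG_of_robustStar` with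
`ρ ≤ ρ₀ < 1`, EVERY member of `MemBallZdG ε₀ ε₁ R` at 't Hooft coupling `β` satisfies the cylinder bound with
`D = max R 1 + 2`, rate `starRate d ρ₀/(max R 1 + 4)` and constant `8√N` — ONE rate and ONE constant for the ball,
the source's size and strength invisible.

MECHANISM. (§0) On a window `Δ` the source does not read, the kernels of `W + V` and `W` COINCIDE
(`perturbedYM_add_eq_of_dependsOn_compl`: the two finite-volume energies differ by `H^V_Δ`, constant on the fibre
`{σ = η off Δ}`, and a tilt by a constant is no tilt). (§1) Hence every DLR state `ν` of `W + V` satisfies the DLR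
equation of `W` for the stars avoiding `S`, and the tree's Dobrushin–Shlosman comparison for a Gibbs pair
(`DobrushinShlosman.abs_integral_sub_integral_le_of_window_pair`, Literature; Föllmer's comparison with a localised
defect in the window setting) with the two-set profile `exists_starProfileR … Δ S` of `StarDoorZd.lean` (usable
stars = those avoiding `S`) gives the bound — the SAME profile that gives ds-2's covariance decay, with `Δg := S`.
WHAT THIS IS NOT: a one-sided comparison rate (the physical screening length may be shorter); the constant does
not resolve the LINEAR response in the source strength (that needs the window comparison WITH DEFECTS, not in the
tree); nothing is claimed about uniqueness for the modified action; lattice strong coupling only, nothing about the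
continuum limit or a Clay-sense mass gap.

References (mechanism; nothing is cited as a named fact): R. L. Dobrushin, S. B. Shlosman (1985), Thm. 1;
H. Föllmer, LNM 1362 (1988), Ch. I, (2.7)–(2.10), Thm. (2.8); H.-O. Georgii (2011) §8.2; L. Gross, J. Stat. Phys.
25 (1981) 57–72 and H. Künsch, CMP 84 (1982) 207–222 (the Gibbs state as a quasi-local function of the interaction).
-/

noncomputable section

open MeasureTheory ProbabilityTheory Function Finset Real
open scoped NNReal
open Literature.Probability.LatticeModels
open Literature.Probability.LatticeModels.DobrushinMetric (IsLipBound)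
open Literature.MathematicalPhysics.QuantumLattice
open Literature.MathematicalPhysics.QuantumFieldTheory hiding ZdEdge Site
open Literature.MathematicalPhysics.QuantumFieldTheory.Balaban1983to89.StrongCouplingDobrushinWindow
  (OneLinkKRModulus)
open Summit.Ventures.YMGap.DSWindowZd
open Summit.Ventures.YMGap.StarResolventDim (Delta gaugeR doorPoly gaugeR_lt_one_of_door)

namespace Summit.Ventures.YMGap.RobustBall

variable {d N : ℕ}

/-! ## §0 The kernels of `W + V` and `W` coincide on every window the source does not read -/

section KernelEquality

variable {G : Type*} [Group G] [TopologicalSpace G] [IsTopologicalGroup G] [CompactSpace G]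
  [MeasurableSpace G] [BorelSpace G] (ρ : G →* Matrix (Fin N) (Fin N) ℂ)

omit [Group G] [TopologicalSpace G] [IsTopologicalGroup G] [CompactSpace G] [BorelSpace G] in
/-- A tilt by a function shifted by a constant is the same tilt: `μ.tilted (f + c) = μ.tilted f` — HYPOTHESIS-FREE
form of `GibbsOfCylinderDLR`'s `tilted_add_const_eq` (any measure, any `f`: the factor `e^{c}` cancels between density
and normaliser, and both sides are `0` when `e^{f}` is not integrable). -/
theorem tilted_add_const_eq' {α : Type*} [MeasurableSpace α] (μ : Measure α) (f : α → ℝ) (c : ℝ) :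
    μ.tilted (fun x => f x + c) = μ.tilted f := by
  unfold Measure.tilted
  congr 1
  funext x
  simp_rw [Real.exp_add]
  rw [integral_mul_const, mul_div_mul_right _ _ (Real.exp_pos c).ne']

/-- **The kernels of `W + V` and of `W` COINCIDE on a window the source does not read.** For link potentials
`W` (listed by `supp`) and `V` (listed by `suppV`, measurable terms) such that every term of `V` does not depend on
the links of `Δ`, the finite-volume kernels in `Δ` of the actions `β S_W + W + V` (listed by `supp ∪ suppV`) and
`β S_W + W` are EQUAL for every boundary condition: the two energies differ by `H^V_Δ`, which is constant (`= H^V_Δ(η)`)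
on the fibre `{σ = η off Δ}` carrying the kernel, and a tilt by a constant is no tilt. -/
theorem perturbedYM_add_eq_of_dependsOn_compl (β : ℝ) {W V : Potential (ZdEdge d) G}
    {supp suppV : Finset (ZdEdge d) → Finset (Finset (ZdEdge d))} (hsupp : W.IsSupportedBy supp)
    (hsuppV : V.IsSupportedBy suppV) (hVm : ∀ A, Measurable (V A)) (Δ : Finset (ZdEdge d))
    (hVoff : ∀ A, DependsOn (V A) ((↑Δ : Set (ZdEdge d))ᶜ)) (η : LGConfig d G) :
    perturbedYM ρ β (W + V) (fun Λ => supp Λ ∪ suppV Λ) Δ η = perturbedYM ρ β W supp Δ η := by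
  classical
  -- the two energies differ by the source Hamiltonian `H^V_Δ`
  have hE : perturbedEnergy ρ β (W + V) (fun Λ => supp Λ ∪ suppV Λ) Δ =
      fun U => perturbedEnergy ρ β W supp Δ U - hamiltonianIn V suppV Δ U := by
    funext U
    simp only [perturbedEnergy]
    rw [hamiltonianIn_add_apply, hamiltonianIn_eq_of_subfamily hsupp (fun Λ => Finset.subset_union_left) Δ,
      hamiltonianIn_eq_of_subfamily hsuppV (supp' := fun Λ => supp Λ ∪ suppV Λ)
        (fun Λ => Finset.subset_union_right) Δ]
    ring
  -- `H^V_Δ` is constant on the fibre `{glueWith Δ ζ η}`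
  have hconst : ∀ ζ : ↥Δ → G, hamiltonianIn V suppV Δ (glueWith Δ ζ η) = hamiltonianIn V suppV Δ η := by
    intro ζ
    unfold hamiltonianIn
    refine Finset.sum_congr rfl fun A _ => hVoff A fun e he => ?_
    exact glueWith_apply_not_mem Δ ζ η fun heΔ => he (Finset.mem_coe.2 heΔ)
  unfold perturbedYM
  rw [hE]
  have hae : (fun U => perturbedEnergy ρ β W supp Δ U - hamiltonianIn V suppV Δ U)
      =ᵐ[(Measure.pi fun _ : ↥Δ => haarProbability G).map (glueWith Δ · η)]
      fun U => perturbedEnergy ρ β W supp Δ U + (-hamiltonianIn V suppV Δ η) := by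
    have hset : MeasurableSet {U : LGConfig d G | hamiltonianIn V suppV Δ U = hamiltonianIn V suppV Δ η} :=
      (measurable_hamiltonianIn hVm suppV Δ) (measurableSet_singleton _)
    have h0 : ∀ᵐ U ∂(Measure.pi fun _ : ↥Δ => haarProbability G).map (glueWith Δ · η),
        hamiltonianIn V suppV Δ U = hamiltonianIn V suppV Δ η :=
      (ae_map_iff (measurable_glueWith Δ η).aemeasurable hset).2 (ae_of_all _ hconst)
    filter_upwards [h0] with U hU
    rw [hU]
    ring
  rw [tilted_congr hae, tilted_add_const_eq']

end KernelEquality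

/-! ## §1 Screening of a local source through the star door: the generic member -/

/-- **LOCAL SOURCES ARE SCREENED THROUGH THE STAR DOOR — floor form.** Member `(W, supp)`: continuous own-link terms,
`ℓ^∞` range `R`, a star window bound for `perturbedYM (fundamentalRep (Fin N)) (N β) W supp` with locality radius
`D ≥ R + 2` and received sum `0 ≤ ρ < 1` (Frobenius weight). Source `(V, suppV)`: bounded, adapted, locally listed,
every term reading only the links of the finite set `S` — ANY strength. Then every DLR state `μ` of the member and
EVERY DLR state `ν` of `W + V` satisfy, for every bounded measurable `f` reading `Δ` with Frobenius-Lipschitz vector `δ`: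
`|∫ f dμ − ∫ f dν| ≤ 2(2√N) · exp(−starRate d ρ · ⌊d(Δ,S)/(D+2)⌋) · Σ_{y ∈ Δ} δ y`
(Literature `DobrushinShlosman.abs_integral_sub_integral_le_of_window_pair` — usable stars = those avoiding `S`,
where the two kernels coincide by `perturbedYM_add_eq_of_dependsOn_compl` — fed with ds-2's profile
`exists_starProfileR … Δ S`). -/
theorem abs_integral_sub_integral_le_of_source_star {β ρ : ℝ} {R D : ℕ}
    {W : Potential (ZdEdge d) (SUN N)} (hWc : ∀ X, Continuous (W X))
    (hWdep : ∀ X, DependsOn (W X) (↑X : Set (ZdEdge d)))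
    {supp : Finset (ZdEdge d) → Finset (Finset (ZdEdge d))} (hsupp : W.IsSupportedBy supp)
    (hR : ∀ e, ∀ X ∈ supp {e}, e ∈ X → ∀ y ∈ X, ‖e.1 - y.1‖ ≤ (R : ℝ)) (hD : R + 2 ≤ D)
    (hρ0 : 0 ≤ ρ) (hρ1 : ρ < 1)
    (h : StarWindowBoundZdR d N (perturbedYM (d := d) (fundamentalRep (Fin N)) (N * β) W supp) D ρ
      suFrobDist)
    {V : Potential (ZdEdge d) (SUN N)} (hV : V.IsAdapted) (hVb : ∀ X, ∃ C, ∀ U, |V X U| ≤ C)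
    {suppV : Finset (ZdEdge d) → Finset (Finset (ZdEdge d))} (hsuppV : V.IsSupportedBy suppV)
    {S : Finset (ZdEdge d)} (hVS : ∀ X, DependsOn (V X) (↑S : Set (ZdEdge d)))
    {μ ν : Measure (LGConfig d (SUN N))}
    (hμ : μ ∈ perturbedGibbsMeasures (d := d) (fundamentalRep (Fin N)) (N * β) W supp)
    (hν : ν ∈ perturbedGibbsMeasures (d := d) (fundamentalRep (Fin N)) (N * β) (W + V)
      (fun Λ => supp Λ ∪ suppV Λ))
    {f : LGConfig d (SUN N) → ℝ} (hfm : Measurable f) {Bf : ℝ} (hBf : ∀ σ, |f σ| ≤ Bf)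
    {Δ : Finset (ZdEdge d)} (hfdep : DependsOn f (↑Δ : Set (ZdEdge d)))
    {δ : ZdEdge d → ℝ} (hδ : IsLipBound suFrobDist f δ) :
    |(∫ σ, f σ ∂μ) - ∫ σ, f σ ∂ν| ≤ 2 * (2 * Real.sqrt N) *
      Real.exp (-(starRate d ρ * ⌊setDistEdges Δ S / (D + 2 : ℕ)⌋₊)) * ∑ y ∈ Δ, δ y := by
  classical
  haveI : SecondCountableTopology (Matrix (Fin N) (Fin N) ℂ) :=
    inferInstanceAs (SecondCountableTopology (Fin N → Fin N → ℂ))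
  haveI : SecondCountableTopology (SUN N) := Topology.IsEmbedding.subtypeVal.secondCountableTopology
  have hW : W.IsAdapted := fun X => ⟨hWdep X, (hWc X).measurable⟩
  have hWb : ∀ X, ∃ C, ∀ U, |W X U| ≤ C := fun X => exists_bound_of_continuous (hWc X)
  have hWV : (W + V).IsAdapted := isAdapted_add hW hV
  have hWVb : ∀ X, ∃ C, ∀ U, |(W + V) X U| ≤ C := fun X => by
    obtain ⟨C₁, h₁⟩ := hWb X; obtain ⟨C₂, h₂⟩ := hVb X
    exact ⟨C₁ + C₂, fun U => (abs_add_le _ _).trans (add_le_add (h₁ U) (h₂ U))⟩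
  have hγ : IsSpecification (perturbedYM (d := d) (fundamentalRep (Fin N)) (N * β) W supp) :=
    isSpecification_perturbedYM _ (continuous_fundamentalRep (Fin N)) _ hW hWb hsupp
  have hγ' : IsSpecification (perturbedYM (d := d) (fundamentalRep (Fin N)) (N * β) (W + V)
      (fun Λ => supp Λ ∪ suppV Λ)) :=
    isSpecification_perturbedYM _ (continuous_fundamentalRep (Fin N)) _ hWV hWVb (isSupportedBy_add_union hsupp hsuppV)
  have hμ' : IsGibbsMeasure (perturbedYM (d := d) (fundamentalRep (Fin N)) (N * β) W supp) μ := hμ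
  have hν' : IsGibbsMeasure (perturbedYM (d := d) (fundamentalRep (Fin N)) (N * β) (W + V)
      (fun Λ => supp Λ ∪ suppV Λ)) ν := hν
  have hD1 : 1 ≤ D := by omega
  have hloc : ∀ (c : ZdEdge d) (ζ ζ' : LGConfig d (SUN N)), (∀ v ∈ starNbhdZdR D c.1, ζ v = ζ' v) →
      ∀ (g : LGConfig d (SUN N) → ℝ), Measurable g → (∃ B, ∀ σ, |g σ| ≤ B) →
        DependsOn g (starWinZd c : Set (ZdEdge d)) →
        ∫ σ, g σ ∂(perturbedYM (d := d) (fundamentalRep (Fin N)) (N * β) W supp (starWinZd c) ζ) =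
          ∫ σ, g σ ∂(perturbedYM (d := d) (fundamentalRep (Fin N)) (N * β) W supp (starWinZd c) ζ') :=
    fun c ζ ζ' hζ g hgm _ hgdep => perturbed_star_hloc _ (continuous_fundamentalRep (Fin N)) _
      (fun X => (hWc X).measurable) hWdep hsupp hR hD c ζ ζ' hζ g hgm hgdep
  -- the kernels of `W + V` and `W` agree on every star avoiding `S`
  have hagree : ∀ c : ZdEdge d, (∀ z ∈ starWinZd c, z ∉ S) → ∀ (σ : LGConfig d (SUN N))
      ⦃g : LGConfig d (SUN N) → ℝ⦄, Measurable g → (∃ B, ∀ τ, |g τ| ≤ B) →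
      ∫ τ, g τ ∂(perturbedYM (d := d) (fundamentalRep (Fin N)) (N * β) (W + V) (fun Λ => supp Λ ∪ suppV Λ)
          (starWinZd c) σ) =
        ∫ τ, g τ ∂(perturbedYM (d := d) (fundamentalRep (Fin N)) (N * β) W supp (starWinZd c) σ) := by
    intro c hc σ g _ _
    have hoff : ∀ A, DependsOn (V A) ((↑(starWinZd c) : Set (ZdEdge d))ᶜ) := fun A =>
      (hVS A).mono fun e heS heW => hc e (Finset.mem_coe.1 heW) (Finset.mem_coe.1 heS)
    rw [perturbedYM_add_eq_of_dependsOn_compl (fundamentalRep (Fin N)) (N * β) hsupp hsuppV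
      (fun A => (hV A).2) (starWinZd c) hoff σ]
  obtain ⟨K, hK0, hKsupp, hcontract, hsum⟩ := h
  have hR₀ : (0 : ℝ) ≤ 2 * Real.sqrt N := by positivity
  obtain ⟨Λ, ℓ, hΔΛ, hU, hℓ, hL⟩ := exists_starProfileR hD1 K hKsupp Δ S
  exact DobrushinShlosman.abs_integral_sub_integral_le_of_window_pair hγ hγ' suFrobDist_nonneg suFrobDist_le hR₀
    (win := starWinZd) (nbhd := fun c => starNbhdZdR D c.1) (K := fun c => K c.1) (fun c y x => hK0 _ _ _)
    self_mem_starWinZd (fun c => vertexStarZd_subset_starNbhdZdR hD1 c.1) (fun c y x => hKsupp _ _ _)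
    hcontract hloc hρ0 hρ1 (fun c x hx => hsum c.1 x hx) (Nstar := 2 * d)
    card_filter_mem_starWinZd_le hμ' hν' (fun c => ∀ z ∈ starWinZd c, z ∉ S) hagree hfm hBf hfdep hδ Λ hΔΛ
    ℓ _ hU hℓ hL

/-- **Exponential reading**: `⌊x⌋ ≥ x − 1` and `e^{starRate d ρ} ≤ 2` give
`|∫ f dμ − ∫ f dν| ≤ 8√N · exp(−(starRate d ρ/(D+2)) · d(Δ,S)) · Σ_{y ∈ Δ} δ y`. -/
theorem abs_integral_sub_integral_le_of_source_star_exp {β ρ : ℝ} {R D : ℕ}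
    {W : Potential (ZdEdge d) (SUN N)} (hWc : ∀ X, Continuous (W X))
    (hWdep : ∀ X, DependsOn (W X) (↑X : Set (ZdEdge d)))
    {supp : Finset (ZdEdge d) → Finset (Finset (ZdEdge d))} (hsupp : W.IsSupportedBy supp)
    (hR : ∀ e, ∀ X ∈ supp {e}, e ∈ X → ∀ y ∈ X, ‖e.1 - y.1‖ ≤ (R : ℝ)) (hD : R + 2 ≤ D)
    (hρ0 : 0 ≤ ρ) (hρ1 : ρ < 1)
    (h : StarWindowBoundZdR d N (perturbedYM (d := d) (fundamentalRep (Fin N)) (N * β) W supp) D ρ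
      suFrobDist)
    {V : Potential (ZdEdge d) (SUN N)} (hV : V.IsAdapted) (hVb : ∀ X, ∃ C, ∀ U, |V X U| ≤ C)
    {suppV : Finset (ZdEdge d) → Finset (Finset (ZdEdge d))} (hsuppV : V.IsSupportedBy suppV)
    {S : Finset (ZdEdge d)} (hVS : ∀ X, DependsOn (V X) (↑S : Set (ZdEdge d)))
    {μ ν : Measure (LGConfig d (SUN N))}
    (hμ : μ ∈ perturbedGibbsMeasures (d := d) (fundamentalRep (Fin N)) (N * β) W supp)
    (hν : ν ∈ perturbedGibbsMeasures (d := d) (fundamentalRep (Fin N)) (N * β) (W + V)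
      (fun Λ => supp Λ ∪ suppV Λ))
    {f : LGConfig d (SUN N) → ℝ} (hfm : Measurable f) {Bf : ℝ} (hBf : ∀ σ, |f σ| ≤ Bf)
    {Δ : Finset (ZdEdge d)} (hfdep : DependsOn f (↑Δ : Set (ZdEdge d)))
    {δ : ZdEdge d → ℝ} (hδ : IsLipBound suFrobDist f δ) :
    |(∫ σ, f σ ∂μ) - ∫ σ, f σ ∂ν| ≤ 8 * Real.sqrt N *
      Real.exp (-(starRate d ρ / (D + 2 : ℕ)) * setDistEdges Δ S) * ∑ y ∈ Δ, δ y := by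
  have key := abs_integral_sub_integral_le_of_source_star hWc hWdep hsupp hR hD hρ0 hρ1 h hV hVb hsuppV hVS hμ hν
    hfm hBf hfdep hδ
  set κ : ℝ := starRate d ρ with hκ
  have hκ0 : 0 < κ := starRate_pos hρ0 hρ1
  have hD2 : (0 : ℝ) < ((D + 2 : ℕ) : ℝ) := by positivity
  have hgeom : Real.exp (-(κ * ⌊setDistEdges Δ S / (D + 2 : ℕ)⌋₊)) ≤
      Real.exp κ * Real.exp (-(κ / (D + 2 : ℕ)) * setDistEdges Δ S) := by
    rw [← Real.exp_add]
    refine Real.exp_le_exp.2 ?_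
    have hfl : setDistEdges Δ S / (D + 2 : ℕ) - 1 ≤ (⌊setDistEdges Δ S / (D + 2 : ℕ)⌋₊ : ℝ) := by
      have := Nat.lt_floor_add_one (setDistEdges Δ S / (D + 2 : ℕ))
      linarith
    have := mul_le_mul_of_nonneg_left hfl hκ0.le
    have e1 : -(κ / (D + 2 : ℕ)) * setDistEdges Δ S = -(κ * (setDistEdges Δ S / (D + 2 : ℕ))) := by
      field_simp
    rw [e1]
    linarith
  have hsum0 : 0 ≤ ∑ y ∈ Δ, δ y := Finset.sum_nonneg fun y _ => hδ.nonneg y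
  have hsq : 0 ≤ Real.sqrt N := Real.sqrt_nonneg _
  have h2 : Real.exp κ ≤ 2 := exp_starRate_le_two hρ0 hρ1.le
  calc |(∫ σ, f σ ∂μ) - ∫ σ, f σ ∂ν|
      ≤ 2 * (2 * Real.sqrt N) * Real.exp (-(κ * ⌊setDistEdges Δ S / (D + 2 : ℕ)⌋₊)) * ∑ y ∈ Δ, δ y := key
    _ ≤ 2 * (2 * Real.sqrt N) * (Real.exp κ * Real.exp (-(κ / (D + 2 : ℕ)) * setDistEdges Δ S)) *
          ∑ y ∈ Δ, δ y := by gcongr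
    _ ≤ 2 * (2 * Real.sqrt N) * (2 * Real.exp (-(κ / (D + 2 : ℕ)) * setDistEdges Δ S)) * ∑ y ∈ Δ, δ y := by
        gcongr
    _ = 8 * Real.sqrt N * Real.exp (-(κ / (D + 2 : ℕ)) * setDistEdges Δ S) * ∑ y ∈ Δ, δ y := by ring

/-- **Lipschitz-cylinder reading** (Shen–Zhu–Zhu's observable class, `Σ δ = #Λ_F · K_F`): for every Lipschitz
cylinder observable `F` on the links `Λ` with constant `K_F`,
`|∫ F dμ − ∫ F dν| ≤ 8√N · exp(−(starRate d ρ/(D+2)) · d(Λ,S)) · #Λ · K_F`. -/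
theorem abs_integral_sub_integral_le_of_source_star_cylinder {β ρ : ℝ} {R D : ℕ}
    {W : Potential (ZdEdge d) (SUN N)} (hWc : ∀ X, Continuous (W X))
    (hWdep : ∀ X, DependsOn (W X) (↑X : Set (ZdEdge d)))
    {supp : Finset (ZdEdge d) → Finset (Finset (ZdEdge d))} (hsupp : W.IsSupportedBy supp)
    (hR : ∀ e, ∀ X ∈ supp {e}, e ∈ X → ∀ y ∈ X, ‖e.1 - y.1‖ ≤ (R : ℝ)) (hD : R + 2 ≤ D)
    (hρ0 : 0 ≤ ρ) (hρ1 : ρ < 1)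
    (h : StarWindowBoundZdR d N (perturbedYM (d := d) (fundamentalRep (Fin N)) (N * β) W supp) D ρ
      suFrobDist)
    {V : Potential (ZdEdge d) (SUN N)} (hV : V.IsAdapted) (hVb : ∀ X, ∃ C, ∀ U, |V X U| ≤ C)
    {suppV : Finset (ZdEdge d) → Finset (Finset (ZdEdge d))} (hsuppV : V.IsSupportedBy suppV)
    {S : Finset (ZdEdge d)} (hVS : ∀ X, DependsOn (V X) (↑S : Set (ZdEdge d)))
    {μ ν : Measure (LGConfig d (SUN N))}
    (hμ : μ ∈ perturbedGibbsMeasures (d := d) (fundamentalRep (Fin N)) (N * β) W supp)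
    (hν : ν ∈ perturbedGibbsMeasures (d := d) (fundamentalRep (Fin N)) (N * β) (W + V)
      (fun Λ => supp Λ ∪ suppV Λ))
    {F : LGConfig d (SUN N) → ℝ} {Λ : Finset (ZdEdge d)} {KF : ℝ≥0}
    (hF : IsLipschitzCylinder (fundamentalRep (Fin N)) F Λ KF) :
    |(∫ σ, F σ ∂μ) - ∫ σ, F σ ∂ν| ≤ 8 * Real.sqrt N *
      Real.exp (-(starRate d ρ / (D + 2 : ℕ)) * setDistEdges Λ S) * (Λ.card * KF) := by
  classical
  have hA : ∀ a b : SUN N, dist (suEntries a) (suEntries b) ≤ 1 * suFrobDist a b :=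
    fun a b => by rw [one_mul]; exact dist_suEntries_le_suFrobDist a b
  have key := abs_integral_sub_integral_le_of_source_star_exp hWc hWdep hsupp hR hD hρ0 hρ1 h hV hVb hsuppV hVS hμ hν
    hF.measurable hF.abs_le hF.dependsOn (hF.isLipBound zero_le_one hA)
  have hsum : ∑ y ∈ Λ, (if y ∈ Λ then (1 : ℝ) * (KF : ℝ) else 0) = Λ.card * KF := by
    rw [Finset.sum_ite_of_true (fun y hy => hy), Finset.sum_const, nsmul_eq_mul, one_mul]
  rw [hsum] at key
  exact key

/-! ## §2 The ball: one screening rate and one constant for every member of `MemBallZdG ε₀ ε₁ R` -/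

/-- **LOCAL SOURCES ARE SCREENED UNIFORMLY ON THE GAUGE-INVARIANT TIER-1 `ℤ^d` BALL, THROUGH THE ROBUST STAR
DOOR.** Under the hypotheses of ds-2's `massGapOnBallZdG_of_robustStar` / `uniformMassGapOnBallZdG_of_robustStar`
(dimension `d ≥ 2`, a one-link modulus `OneLinkKRModulus N Rm K` on `Rm ≥ 2(d−1)·N|β|/N`, robust coefficient
`K e^{ε₀}(1 + 2√N ε₁)|β| ≤ c` below the door `doorPoly d c < 1`, `λ ≥ √N ε₁`, `θ = (2d−2)c + λ < 1`, received sum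
`ρ = gaugeR d c + (λ + θ^Kn·4dλ)/(1−θ) ≤ ρ₀ < 1`): for EVERY member `(W, supp)` of `MemBallZdG ε₀ ε₁ R` at 't Hooft
coupling `β`, every bounded adapted source `V` (listed by `suppV`) whose terms read only the links of the finite set
`S` — any strength —, every DLR state `μ` of the member, EVERY DLR state `ν` of `W + V` and every Lipschitz cylinder `F`:
`|∫ F dμ − ∫ F dν| ≤ 8√N · exp(−(starRate d ρ₀/(max R 1 + 4)) · d(Λ_F,S)) · #Λ_F · K_F`. -/
theorem localScreeningStar_of_memBallZdG (hd : 2 ≤ d) (hN : 1 ≤ N) {β ε₀ ε₁ Rm K c lam θ ρ ρ₀ : ℝ}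
    {R Kn : ℕ} (hK : 0 ≤ K) (hRm : |(N : ℝ) * β| / N * (2 * ((d : ℝ) - 1)) ≤ Rm) (hmod : OneLinkKRModulus N Rm K)
    (hε₁ : 0 ≤ ε₁) (hc : K * Real.exp ε₀ * (1 + 2 * Real.sqrt N * ε₁) * (|(N : ℝ) * β| / N) ≤ c)
    (hlam : Real.sqrt N * ε₁ ≤ lam) (hθ : θ = (2 * (d : ℝ) - 2) * c + lam) (hθ1 : θ < 1)
    (hcd : doorPoly d c < 1) (hρ : ρ = gaugeR d c + (lam + θ ^ Kn * (4 * d * lam)) / (1 - θ)) (hρle : ρ ≤ ρ₀)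
    (hρ1 : ρ₀ < 1)
    {W : Potential (ZdEdge d) (SUN N)} {supp : Finset (ZdEdge d) → Finset (Finset (ZdEdge d))}
    (hW : MemBallZdG ε₀ ε₁ R W supp)
    {V : Potential (ZdEdge d) (SUN N)} (hV : V.IsAdapted) (hVb : ∀ X, ∃ C, ∀ U, |V X U| ≤ C)
    {suppV : Finset (ZdEdge d) → Finset (Finset (ZdEdge d))} (hsuppV : V.IsSupportedBy suppV)
    {S : Finset (ZdEdge d)} (hVS : ∀ X, DependsOn (V X) (↑S : Set (ZdEdge d)))
    {μ ν : Measure (LGConfig d (SUN N))}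
    (hμ : μ ∈ perturbedGibbsMeasures (d := d) (fundamentalRep (Fin N)) (N * β) W supp)
    (hν : ν ∈ perturbedGibbsMeasures (d := d) (fundamentalRep (Fin N)) (N * β) (W + V)
      (fun Λ => supp Λ ∪ suppV Λ))
    {F : LGConfig d (SUN N) → ℝ} {Λ : Finset (ZdEdge d)} {KF : ℝ≥0}
    (hF : IsLipschitzCylinder (fundamentalRep (Fin N)) F Λ KF) :
    |(∫ σ, F σ ∂μ) - ∫ σ, F σ ∂ν| ≤ 8 * Real.sqrt N *
      Real.exp (-(starRate d ρ₀ / (max R 1 + 4 : ℕ)) * setDistEdges Λ S) * (Λ.card * KF) := by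
  have hc0 : 0 ≤ c := le_trans (by positivity) hc
  have hlam0 : 0 ≤ lam := le_trans (by positivity) hlam
  have hgR : 0 ≤ gaugeR d c ∧ gaugeR d c < 1 := gaugeR_lt_one_of_door hd hc0 hcd
  have hd2 : (2 : ℝ) ≤ d := by exact_mod_cast hd
  have hθ0 : 0 ≤ θ := by rw [hθ]; nlinarith
  have h1θ : 0 < 1 - θ := by linarith
  have hρ00 : 0 ≤ ρ := by
    rw [hρ]
    refine add_nonneg hgR.1 (div_nonneg (add_nonneg hlam0 ?_) h1θ.le)
    have : 0 ≤ θ ^ Kn := pow_nonneg hθ0 Kn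
    positivity
  have hρ₀0 : 0 ≤ ρ₀ := hρ00.trans hρle
  have hwin := (starWindowBoundZdR_of_memBallZdG hd hN hK hRm hmod hε₁ hc hlam hθ hθ1 hcd hρ hW).mono_rho hρle
  have hD : R + 2 ≤ max R 1 + 2 := by omega
  have key := abs_integral_sub_integral_le_of_source_star_cylinder hW.continuous hW.dependsOn hW.supportedBy hW.range
    hD hρ₀0 hρ1 hwin hV hVb hsuppV hVS hμ hν hF
  have e4 : (max R 1 + 2 + 2 : ℕ) = max R 1 + 4 := by omega
  rw [e4] at key
  exact key

end Summit.Ventures.YMGap.RobustBall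

end
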